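import Summits.ResolutionOfSingularities.ResolutionOfSingularities.Theorems.EquisingularLiftEquisingularLiftNatNoseTowerBTriplePrimeOfFact
import Summits.ResolutionOfSingularities.ResolutionOfSingularities.Theorems.EquisingularLiftEquisingularLiftNatModelStepChain
import Summits.ResolutionOfSingularities.ResolutionOfSingularities.Theorems.EquisingularLiftEquisingularLiftNatCentreOffGeneric
import Summits.ResolutionOfSingularities.ResolutionOfSingularities.Theorems.EquisingularLiftEquisingularLiftChainRegular
import Summits.ResolutionOfSingularities.ResolutionOfSingularities.Theorems.EquisingularLiftEquisingularLiftCentreBlowupSmooth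
import Literature.AlgebraicGeometry.Resolution.BlowupsExistence
import Summits.ResolutionOfSingularities.ResolutionOfSingularities.Theorems.EquisingularLiftEquisingularLiftNatResidueHypDefs5
import HarnessLib

/-!
# [OURS · L1 W4.5(b) · EL♮(3) · NOSE] (N4) THE HSUB SUPPLIER OF THE POINTS-FIRST NOSE RUNG (R-ν2) — `hsub_reachPtNoseBTriplePrime_of_fact`

res-L1-w45b-nose-w2 g0 (WIDTH seat, nose row; NOSE WORD v1 `Cruxes/EquisingularLiftNatThree/NOSE-WORD-v1.md`, desk R33 (δ) / R36 (β)). OURS; NOT a statement of any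
manuscript ([Hironaka2017] is a candidate under adjudication, nothing of it is asserted); AI-written, weaker than expert review. No `sorry`; standard axioms; DEF-FREE;
`--supports stmt-ResolutionOfSingularities-20148 --as helper`. Resolution of singularities in positive characteristic is NOT proved here or anywhere in this chain.

WHAT. K5′'s sub-chain supplier slot HSUB(Reach) (res-L1-w45b-lead-2 `target_elnat_of_subchainResolution'`, …NatSubchainPointResolutionOff) at
`Reach := ReachPtNoseBTriplePrime` (res-type-027 `…NatResidueHypDefs5`, (N0) of the word: the NOSE MOVE one floor up — a closed `Z ⊆ T₂` in the k-stage `F₂` after a point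
step, `T₂ ⊄ Z`, `Z` infinite with the curve clause, `Z̃` regular, `F₂` regular along `Z`, UNOBSTRUCTED `DirStepUnobs F₂ univ _ Z hZ` (`H¹(Z̃, 𝒩) = 0`, Čech form), then the blow-up
of `𝓘⟨Z⟩` and a B‴ chain `TowerPtRegB₄`/`TowerPtRamB₄`/`TowerRoundBTriplePrime`), CLOSED OVER the registered NEED-FACT (T-k) in its per-base form `EmbeddedCurveLift O k θ P q`:
(N1) the centre `C ⊆ X₁` is ONE application of `EmbeddedCurveLiftAt O k θ X₁ (τ₁ ≫ σ') q ⊥` (the `𝓔 = ⊥` instance: `V(⊥) = X₁` is regular — stalk maps of the isomorphism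
`(⊥).subschemeι` —, flat over `O` — `flat_of_isIntegral_of_isDominant` —, proper — `StrataSplit.chain_isRegular` + `IsBlowup.isProper` —; trace clause `(⊥).comap j₂ = 𝓘⟨univ⟩` by
`comap_bot`, `vanishingIdeal_top`, `Scheme.nilradical_eq_bot` on the integral `F₂`); (N3) E1-legality of `C` upstairs by res-L1-w45b-stub-4's
`image_support_subset_not_isGenericPoint_of_chain`; the upstairs blow-up of `C` and the model square of the downstairs nose blow-up by `exists_isBlowup` + `modelStep_chain`;
and the B‴ tail matched by res-L1-w45b-stub-4's STAGE-GENERIC nose engine‴ `hsub_reachNoseTowerBTriplePrime_of_fact'` (✓ p647499, the binder-drop re-cut of ✓ p628868).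
Consumed by the rung `stub_elnat_pointsFirstNoseTowerBTriplePrimeResolutionThree` (…NatNosePointsFirstRung). [OURS · L1 W4.5b · nose (R-ν2)]
-/

set_option linter.dupNamespace false -- mandated namespace `Summit.<Summit>.<Problem>` of this single-conjunct summit
set_option linter.overlappingInstances false -- signatures carry `[IsDomain O] [IsDiscreteValuationRing O]`

noncomputable section

open CategoryTheory CategoryTheory.Limits AlgebraicGeometry TopologicalSpace Topology IsLocalRing
open Literature.AlgebraicGeometry.Resolution
open AlgebraicGeometry.Scheme.IdealSheafData
open Summit.ResolutionOfSingularities.ResolutionOfSingularities.Theses.EquisingularLift.Split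
open Summit.ResolutionOfSingularities.ResolutionOfSingularities.Cruxes.EquisingularLift.StrataSplit

namespace Summit.ResolutionOfSingularities.ResolutionOfSingularities.Cruxes.EquisingularLiftNat.Sections

/-- **(N4) THE HSUB SUPPLIER of the points-first nose rung (R-ν2)** — K5′'s `Reach` slot at `Reach := ReachPtNoseBTriplePrime`, from (T-k) `EmbeddedCurveLift O k θ P q`:
in the point-step context of K5′ (stage `X₁` after the section blow-up, model square `j₂ : F₂ ⟶ X₁`), the nose data of `ReachPtNoseBTriplePrime` give the centre
`C ⊆ X₁` by (T-k) AT `𝓔 = ⊥` (N1), its blow-up and model by `modelStep_chain`, E1-legality upstairs by `image_support_subset_not_isGenericPoint_of_chain` (N3), and the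
B‴ tail is matched by res-L1-w45b-stub-4's stage-generic nose engine‴ (✓p628868; its `_hCsm`-free re-cut `…_of_fact'` ✓p647499). [folklore glue over the named tree theorems; no new mathematics] [OURS · L1 W4.5b · nose (R-ν2)] -/
theorem hsub_reachPtNoseBTriplePrime_of_fact (k : Type) [Field k]
    (O : Type) [CommRing O] [IsDomain O] [IsDiscreteValuationRing O] [IsAdicComplete (IsLocalRing.maximalIdeal O) O]
    [IsAlgClosed (IsLocalRing.ResidueField O)] (θ : O →+* k) (hθ : Function.Surjective θ)
    (P : Scheme.{0}) (q : P ⟶ Spec (.of O))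
    -- (T-k)
    (hFact : EmbeddedCurveLift O k θ P q)
    (Y : Set P) (Ch : ∀ X' : Scheme.{0}, (X' ⟶ P) → Set X' → Prop)
    (hChStep : ∀ (X' X'' : Scheme.{0}) (σ' : X' ⟶ P) (S' : Set X') (C : X'.IdealSheafData) (τ : X'' ⟶ X'),
      Ch X' σ' S' → IsBlowup τ C → Scheme.IsRegular C.subscheme → Flat (C.subschemeι ≫ σ' ≫ q) →
      σ' '' (C.support : Set X') ⊆ {y | ¬ IsGenericPoint y Y} →
      (C.support : Set X') ∩ (σ' ≫ q) ⁻¹' {IsLocalRing.closedPoint O} ⊆ S' →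
      Ch X'' (τ ≫ σ') (closure (τ ⁻¹' (S' \ (C.support : Set X')))))
    (hChSplit : ∀ (X' : Scheme.{0}) (σ' : X' ⟶ P) (S' : Set X'), Ch X' σ' S' → Chain P Y X' σ' S')
    (hYsp : Y ⊆ q ⁻¹' {IsLocalRing.closedPoint O}) (hYirr : IsIrreducible Y) (hYcl : IsClosed Y) (hPint : IsIntegral P)
    (hPnoeth : IsLocallyNoetherian P) (hPreg : Scheme.IsRegular P) (hqprop : IsProper q) (hqsm : SmoothOfRelativeDimension 3 q)
    -- the stage before the point step and its model
    (X' : Scheme.{0}) (σ' : X' ⟶ P) (S' : Set X') (hCh' : Ch X' σ' S') (_hX'int : IsIntegral X') (hX'noeth : IsLocallyNoetherian X')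
    (_hX'reg : Scheme.IsRegular X') (_hX'dom : IsDominant (σ' ≫ q))
    (F₁ : Scheme.{0}) (_hF₁ : IsIntegral F₁) (j : F₁ ⟶ X') (t : F₁ ⟶ Spec (.of k))
    (_hsq : IsPullback j t (σ' ≫ q) (Spec.map (CommRingCat.ofHom θ)))
    (T₁ : Set F₁) (_hT₁cl : IsClosed T₁) (_hT₁irr : IsIrreducible T₁) (_hjT₁ : j '' T₁ = S')
    -- the point step
    (x : F₁) (hx : IsClosed ({x} : Set F₁)) (U : X'.Opens) (_hU : Smooth (U.ι ≫ σ' ≫ q))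
    (s : Spec (.of O) ⟶ X') (_hs : s ≫ σ' ≫ q = 𝟙 _) (_hsU : s (IsLocalRing.closedPoint O) ∈ U) (_hsx : s (IsLocalRing.closedPoint O) = j x)
    (_hsdim : ringKrullDim (X'.presheaf.stalk (s (IsLocalRing.closedPoint O))) = ((3 + 1 : ℕ) : WithBot ℕ∞))
    (_hregx : IsRegularLocalRing (F₁.presheaf.stalk x)) (_hsoff : ∀ c ∈ (s.ker.support : Set X'), ¬ IsGenericPoint (σ' c) Y)
    (X₁ : Scheme.{0}) (τ₁ : X₁ ⟶ X') (hτ₁ : IsBlowup τ₁ s.ker) (hX₁int : IsIntegral X₁) (hX₁noeth : IsLocallyNoetherian X₁)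
    (hX₁reg : Scheme.IsRegular X₁) (hX₁dom : IsDominant ((τ₁ ≫ σ') ≫ q))
    (F₂ : Scheme.{0}) (hF₂ : IsIntegral F₂) (υ : F₂ ⟶ F₁) (_hυ : IsBlowup υ (vanishingIdeal (⟨{x}, hx⟩ : Closeds F₁)))
    (j₂ : F₂ ⟶ X₁) (t₂ : F₂ ⟶ Spec (.of k)) (hsq₂ : IsPullback j₂ t₂ ((τ₁ ≫ σ') ≫ q) (Spec.map (CommRingCat.ofHom θ)))
    (_hcomm : j₂ ≫ τ₁ = υ ≫ j) (_hexc : (s.ker.comap τ₁).comap j₂ = (vanishingIdeal (⟨{x}, hx⟩ : Closeds F₁)).comap υ)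
    (hirr : IsIrreducible (closure (υ ⁻¹' (T₁ \ {x})))) (hCh₁ : Ch X₁ (τ₁ ≫ σ') (j₂ '' closure (υ ⁻¹' (T₁ \ {x}))))
    -- the admissible downstairs sub-chain
    (F₉ : Scheme.{0}) (β : F₉ ⟶ F₂) (T₉ : Set F₉) (hReach : ReachPtNoseBTriplePrime F₁ F₂ υ x (closure (υ ⁻¹' (T₁ \ {x}))) F₉ β T₉) :
    ∃ (X₉ : Scheme.{0}) (σ₉ : X₉ ⟶ P) (S₉ : Set X₉) (j₉ : F₉ ⟶ X₉) (t₉ : F₉ ⟶ Spec (.of k)),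
      Ch X₉ σ₉ S₉ ∧ IsIntegral X₉ ∧ IsLocallyNoetherian X₉ ∧ Scheme.IsRegular X₉ ∧ IsDominant (σ₉ ≫ q) ∧
      IsPullback j₉ t₉ (σ₉ ≫ q) (Spec.map (CommRingCat.ofHom θ)) ∧ j₉ '' T₉ = S₉ ∧ IsClosed T₉ ∧ IsIrreducible T₉ ∧ IsIntegral F₉ := by
  classical
  obtain ⟨Z, hZ, hZT, hTZ, hZinf, hZdim, hZreg, hGreg, hunobs, F₃, υ', hυ', γ', E', Es', Ns', K', htower, hβ⟩ := hReach
  haveI := hPint; haveI := hPnoeth; haveI := hX'noeth; haveI := hX₁int; haveI := hX₁noeth; haveI := hF₂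
  set T₂ : Set F₂ := closure (υ ⁻¹' (T₁ \ {x})) with hT₂
  -- properness of the stages over `O`
  obtain ⟨-, -, hσ'prop⟩ := chain_isRegular P Y X' σ' S' (hChSplit _ _ _ hCh') hPnoeth hPreg
  haveI := hσ'prop
  haveI : IsProper q := hqprop
  haveI : IsProper τ₁ := hτ₁.isProper
  haveI : IsDominant ((τ₁ ≫ σ') ≫ q) := hX₁dom
  -- (N1) the centre from (T-k) at `𝓔 = ⊥` on the stage `X₁`, model `j₂ : F₂ ⟶ X₁`
  have hbotreg : Scheme.IsRegular (⊥ : X₁.IdealSheafData).subscheme := by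
    intro y
    haveI := hX₁reg ((⊥ : X₁.IdealSheafData).subschemeι y)
    exact IsRegularLocalRing.of_ringEquiv (asIso ((⊥ : X₁.IdealSheafData).subschemeι.stalkMap y)).commRingCatIsoToRingEquiv
  have hflat₁ : Flat ((τ₁ ≫ σ') ≫ q) := flat_of_isIntegral_of_isDominant ((τ₁ ≫ σ') ≫ q)
  haveI := hflat₁
  have hbotflat : Flat ((⊥ : X₁.IdealSheafData).subschemeι ≫ (τ₁ ≫ σ') ≫ q) := inferInstance
  have hbotprop : IsProper ((⊥ : X₁.IdealSheafData).subschemeι ≫ (τ₁ ≫ σ') ≫ q) := inferInstance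
  obtain ⟨C, -, hCreg, hCfl, hCj, _hCqr⟩ := hFact X₁ (τ₁ ≫ σ') ⊥ hX₁int hX₁noeth hX₁reg hbotreg hbotflat hbotprop F₂ j₂ t₂ hsq₂
    Set.univ isClosed_univ
    (by rw [Scheme.IdealSheafData.comap_bot, show (⟨Set.univ, isClosed_univ⟩ : Closeds F₂) = ⊤ from rfl, vanishingIdeal_top,
      Scheme.nilradical_eq_bot])
    Z hZ (Set.subset_univ Z) hZreg hGreg hunobs
  -- (N3) E1-legality of `C` upstairs: off the generic point of `Y`
  have hoff : (τ₁ ≫ σ') '' (C.support : Set X₁) ⊆ {y : P | ¬ IsGenericPoint y Y} :=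
    image_support_subset_not_isGenericPoint_of_chain θ hθ q Y hYsp (τ₁ ≫ σ') (j₂ '' T₂) (hChSplit _ _ _ hCh₁) j₂ t₂ hsq₂ T₂ rfl C Z hZ hCj hTZ
  have hCoff : ∀ c ∈ (C.support : Set X₁), ¬ IsGenericPoint ((τ₁ ≫ σ') c) Y := fun c hc => hoff ⟨c, hc, rfl⟩
  -- the upstairs blow-up of `C` and the model square for the downstairs nose blow-up `υ'` (`modelStep_chain`)
  have hDT : (((vanishingIdeal (⟨Z, hZ⟩ : Closeds F₂)) : F₂.IdealSheafData).support : Set F₂) ⊆ T₂ := by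
    rw [Scheme.IdealSheafData.coe_support_vanishingIdeal]; exact hZT
  have hTD : ¬ T₂ ⊆ (((vanishingIdeal (⟨Z, hZ⟩ : Closeds F₂)) : F₂.IdealSheafData).support : Set F₂) := by
    rw [Scheme.IdealSheafData.coe_support_vanishingIdeal]; exact hTZ
  obtain ⟨X₂, τ₂, hτ₂⟩ := exists_isBlowup X₁ C
  obtain ⟨hX₂i, hX₂n, hX₂r, hX₂dom, hF₃i, hirr₃, j₃, t₃, hsq₃, hcomm₃, hCh₃⟩ :=
    modelStep_chain O k θ hθ P q Y hYirr hYcl Ch hChSplit hChStep X₁ (τ₁ ≫ σ') (j₂ '' T₂) hCh₁ hX₁reg hX₁dom F₂ j₂ t₂ hsq₂ T₂ rfl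
      C (vanishingIdeal (⟨Z, hZ⟩ : Closeds F₂)) hCj hCreg hCfl hoff hDT hTD X₂ τ₂ hτ₂ F₃ υ' hυ'
  rw [Scheme.IdealSheafData.coe_support_vanishingIdeal] at hirr₃ hCh₃
  have hexc₃ : (C.comap τ₂).comap j₃ = (vanishingIdeal (⟨Z, hZ⟩ : Closeds F₂)).comap υ' := by
    rw [← Scheme.IdealSheafData.comap_comp, hcomm₃, Scheme.IdealSheafData.comap_comp, hCj]
  -- the stage-generic nose engine‴ (res-L1-w45b-stub-4 ✓p628868; `_hCsm`-free re-cut) on the B‴ tail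
  have heng := hsub_reachNoseTowerBTriplePrime_of_fact' k O θ hθ P q Y Ch hChStep hChSplit hYsp hYirr hYcl hPint hPnoeth hPreg hqprop hqsm
    X₁ (τ₁ ≫ σ') (j₂ '' T₂) hCh₁ hX₁int hX₁noeth hX₁reg hX₁dom F₂ hF₂ j₂ t₂ hsq₂ T₂ isClosed_closure hirr rfl
    Z hZ hZT hTZ hZinf hZdim C hCreg hCfl hCj hCoff X₂ τ₂ hτ₂ hX₂i hX₂n hX₂r hX₂dom F₃ hF₃i υ' hυ' j₃ t₃ hsq₃ hcomm₃ hexc₃ hirr₃ hCh₃ hFact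
    F₉ γ' T₉ E' K' ⟨Es', Ns', htower⟩
  exact heng

end Summit.ResolutionOfSingularities.ResolutionOfSingularities.Cruxes.EquisingularLiftNat.Sections

end
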